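import Summits.QuantumAdvantage.QuantumAdvantage.Theorems.NearExactIsExact.Negative.TriangularBqqFive
import Summits.QuantumAdvantage.QuantumAdvantage.Theorems.NearExactIsExact.Negative.CylinderWindowBqq

/-!
# `NearExactIsExact` (stmt-QuantumAdvantage-14043) — negative side: **THEOREM BQQ^tri₅ in full** (disprover gen 38, DISPROOF §46)

Every frame-preserving pair of mutually inverse coordinatewise-quadratic maps of `𝔽₂^{k+5}` (first `k` coordinates
preserved; nonlinear block of 5 bits) satisfies BQQ for every pair of cubics: `R = c₁ ⊕ c₂∘π` is `≡ 0` or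
`2·wt(R) ≥ 2^{k+1}` (`wt(R) ≥ 2^{m−5}`, `m = k+5`).  Assembly of `TriangularBqqFive.bqq_triangular_five_or_cylinder`
(gen 36: BQQ or cylinder) with `CylinderWindowBqq.bqq_of_cylinder` (gen 38: cylinder ⇒ BQQ, via THEOREM CYL6 + D2).
Affine-invariant reading (DISPROOF §45.11): every biquadratic permutation of `𝔽₂^m` with `≥ m − 5` independent affine
components satisfies BQQ(m); a BQ-violating map (residual a codim-6 flat) has `naff ≤ m − 6`.
MM consequence: `Φ = 1 ∨ Φ ≤ 15/16` for the Maiorana–McFarland pairs over such maps, every `n = 2(k+5)`.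
HONEST FRAMING: structure theorem on the NEGATIVE side of the crux; no Theses statement asserted; standard axioms;
NOT summit progress.
-/

set_option linter.dupNamespace false -- D-0017: single-problem summit ⇒ `QuantumAdvantage.QuantumAdvantage` by design

namespace Summit.QuantumAdvantage.QuantumAdvantage.Theorems.NearExactIsExact.Negative.TriangularBqqFiveFull

open Finset
open Literature.Computability.QuantumComplexity
open Summit.QuantumAdvantage.QuantumAdvantage.Theorems.NearExactIsExact.Negative.TriangularBqqFive
  (bqq_triangular_five_or_cylinder)
open Summit.QuantumAdvantage.QuantumAdvantage.Theorems.NearExactIsExact.Negative.CylinderWindowBqq (bqq_of_cylinder)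

variable {k : ℕ}

/-- **THEOREM BQQ^tri₅ (all dimensions).** `π, τ` mutually inverse coordinatewise-quadratic maps of `𝔽₂^{k+5}` with
`π` preserving the first `k` coordinates, `c₁, c₂` cubic: `c₁ ⊕ c₂∘π ≡ 0` or `2·wt(c₁ ⊕ c₂∘π) ≥ 2^{k+1}`. [folklore] -/
theorem bqq_triangular_five (π τ : (Fin (k + 5) → Bool) → (Fin (k + 5) → Bool))
    (hπ : ∀ i, IsDegLeFun 2 (fun z => π z i)) (hτ : ∀ i, IsDegLeFun 2 (fun z => τ z i))
    (hτπ : ∀ z, τ (π z) = z) (hpres : ∀ z (i : Fin k), π z (Fin.castAdd 5 i) = z (Fin.castAdd 5 i))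
    (c₁ c₂ : (Fin (k + 5) → Bool) → Bool) (h₁ : IsDegLeFun 3 c₁) (h₂ : IsDegLeFun 3 c₂) :
    (∀ z, c₁ z = c₂ (π z)) ∨
      2 ^ (k + 1) ≤ 2 * #(univ.filter fun z : Fin (k + 5) → Bool => (c₁ z ^^ c₂ (π z)) = true) := by
  rcases bqq_triangular_five_or_cylinder π τ hπ hτ hτπ hpres c₁ c₂ h₁ h₂ with h0 | hbig | hcyl
  · exact Or.inl h0
  · exact Or.inr hbig
  · exact bqq_of_cylinder π τ hπ hτ hτπ hpres c₁ c₂ h₁ h₂ hcyl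

end Summit.QuantumAdvantage.QuantumAdvantage.Theorems.NearExactIsExact.Negative.TriangularBqqFiveFull
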